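import Literature.NumberTheory.LFunctions.FeketePolyaKernelCertificatesBlockWrappers
import HarnessLib

/-!
# No real zero for real primitive characters of conductor `11420 ≤ q ≤ 12342`: the Fekete–Pólya rows, in the kernel (rows deferred by the earlier engines)

Topic `Literature/NumberTheory/LFunctions`; namespace `Literature.NumberTheory.LFunctions`. THEOREMS only (no
definition, no named fact, no `sorry`; standard axioms): one PUBLIC theorem **`noRealZero{Odd,Even}_fp_<q>`** per
fundamental discriminant `D`, `|D| = q ∈ [11420, 12342]`, that admits a Fekete–Pólya witness but was DEFERRED by the per-position engines v1/v2 (walk too long for one `decide`) — for every primitive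
quadratic `χ` mod `q` of the parity of `D` and every `σ ∈ (0, 1)`, `L(σ, χ) ≠ 0` (statement shape of the
`interval_cases` bullets of the `NoRealZero{Odd,Even}…` range files, so a range assembly cites them by name).
Cell `parity-realchar`, kernel floor of the wide column (TARGET §2 row 19), Fekete–Pólya lane (seat prover-2).

Method (engine v4): `FeketePolyaKernelCertificatesBlock{,Wrappers}.lean` — the iterated partial sums of order
`K` of the induced character `χ↑(q·w)` are non-negative over one period, decided in the kernel BLOCKWISE on packed
base-`2^b` digits (`blockCert b B K (q·w) (tabs… b ps q w)`: sign tables of the character from the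
quadratic-residue bitsets of the prime factors of the conductor — the factor list is part of each certificate,
primality by `norm_num` — prefix sums by one big-integer multiplication per order and block, sign test by one
AND), hence `ℜL(σ, χ↑(q·w)) > 0` (Fekete–Pólya 1912 / MV §11.2.1 Exercise 7) and `L(σ, χ) ≠ 0` (positive Euler
factors, Exercise 8).  Witnesses `(w, K)` = the cheapest in the exact integer scan of this seat
(`HOME/parity-realchar-prover-2/fp-witnesses-*.tsv`; no kit); the digit width `b` is two bits above the size of
the running-sum bound recorded by the scan.  19 characters in this file (est. 80 kernel-s).
NOT covered here (no Fekete–Pólya witness with `w ≤ 40`, `q·w ≤ 4·10⁵`, `K ≤ 12`; the other Fekete–Pólya rows of this range are in the `NoRealZeroFeketePolyaX…` files) — left to the truncation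
certificates of the companion lane: see those files.

## References

* H. L. Montgomery, R. C. Vaughan, *Multiplicative Number Theory I*, CUP 2007, §9.3 Thm 9.13, §11.2.1
  Exercises 7–8. [MontgomeryVaughan2007]
* M. Fekete, G. Pólya, *Über ein Problem von Laguerre*, Rend. Circ. Mat. Palermo 34 (1912) 89–120. [FeketePolya1912]
-/

namespace Literature.NumberTheory.LFunctions

open FeketePolyaKernel

set_option maxHeartbeats 400000 in
/-- `D = 11420`: the even character `χ₋₄·(·/2855)` of conductor `11420` (`2855`: 5 · 571) — Fekete–Pólya witness of order `4` along the induced modulus `11420·21 = 239820`, block certificate (digits of `58` bits, splitting depth `9`); est. `3.2` kernel-s. [cite: MontgomeryVaughan2007, §11.2.1 Exercises 7 (g), 8] -/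
theorem noRealZeroEven_fp_11420 :
    ∀ χ : DirichletCharacter ℂ 11420, χ.IsQuadratic → χ.IsPrimitive → χ.Even →
      ∀ σ : ℝ, 0 < σ → σ < 1 → χ.LFunction σ ≠ 0 :=
  good_even_of_four_blk [5, 571] (by norm_num) (by decide) (by decide) 21 4 58 9 (by decide) (by decide) (by decide)
    (Or.inr (by decide +kernel))

set_option maxHeartbeats 400000 in
/-- `D = -11524`: the odd character `χ₋₄·(·/2881)` of conductor `11524` (`2881`: 43 · 67) — Fekete–Pólya witness of order `4` along the induced modulus `11524·21 = 242004`, block certificate (digits of `60` bits, splitting depth `9`); est. `3.2` kernel-s. [cite: MontgomeryVaughan2007, §11.2.1 Exercises 7 (g), 8] -/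
theorem noRealZeroOdd_fp_11524 :
    ∀ χ : DirichletCharacter ℂ 11524, χ.IsQuadratic → χ.IsPrimitive → χ.Odd →
      ∀ σ : ℝ, 0 < σ → σ < 1 → χ.LFunction σ ≠ 0 :=
  good_odd_of_four_blk [43, 67] (by norm_num) (by decide) (by decide) 21 4 60 9 (by decide) (by decide) (by decide)
    (Or.inr (by decide +kernel))

set_option maxHeartbeats 400000 in
/-- `D = -11559`: the odd character `(·/11559)` of conductor `11559` (`11559`: 3 · 3853) — Fekete–Pólya witness of order `7` along the induced modulus `11559·11 = 127149`, block certificate (digits of `101` bits, splitting depth `9`); est. `4.8` kernel-s. [cite: MontgomeryVaughan2007, §11.2.1 Exercises 7 (g), 8] -/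
theorem noRealZeroOdd_fp_11559 :
    ∀ χ : DirichletCharacter ℂ 11559, χ.IsQuadratic → χ.IsPrimitive → χ.Odd →
      ∀ σ : ℝ, 0 < σ → σ < 1 → χ.LFunction σ ≠ 0 :=
  good_odd_of_odd_blk [3, 3853] (by norm_num) (by decide) (by decide) 11 7 101 9 (by decide) (by decide) (by decide)
    (Or.inr (by decide +kernel))

set_option maxHeartbeats 400000 in
/-- `D = -11563`: the odd character `(·/11563)` of conductor `11563` (`11563`: 31 · 373) — Fekete–Pólya witness of order `4` along the induced modulus `11563·30 = 346890`, block certificate (digits of `62` bits, splitting depth `10`); est. `4.7` kernel-s. [cite: MontgomeryVaughan2007, §11.2.1 Exercises 7 (g), 8] -/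
theorem noRealZeroOdd_fp_11563 :
    ∀ χ : DirichletCharacter ℂ 11563, χ.IsQuadratic → χ.IsPrimitive → χ.Odd →
      ∀ σ : ℝ, 0 < σ → σ < 1 → χ.LFunction σ ≠ 0 :=
  good_odd_of_odd_blk [31, 373] (by norm_num) (by decide) (by decide) 30 4 62 10 (by decide) (by decide) (by decide)
    (Or.inr (by decide +kernel))

set_option maxHeartbeats 400000 in
/-- `D = 11717`: the even character `(·/11717)` of conductor `11717` (`11717`: prime) — Fekete–Pólya witness of order `6` along the induced modulus `11717·10 = 117170`, block certificate (digits of `84` bits, splitting depth `9`); est. `4.1` kernel-s. [cite: MontgomeryVaughan2007, §11.2.1 Exercises 7 (g), 8] -/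
theorem noRealZeroEven_fp_11717 :
    ∀ χ : DirichletCharacter ℂ 11717, χ.IsQuadratic → χ.IsPrimitive → χ.Even →
      ∀ σ : ℝ, 0 < σ → σ < 1 → χ.LFunction σ ≠ 0 :=
  good_even_of_odd_blk [11717] (by norm_num) (by decide) (by decide) 10 6 84 9 (by decide) (by decide) (by decide)
    (Or.inr (by decide +kernel))

set_option maxHeartbeats 400000 in
/-- `D = 11752`: the even character `χ₈·(·/1469)` of conductor `11752` (`1469`: 13 · 113) — Fekete–Pólya witness of order `6` along the induced modulus `11752·17 = 199784`, block certificate (digits of `88` bits, splitting depth `10`); est. `5.8` kernel-s. [cite: MontgomeryVaughan2007, §11.2.1 Exercises 7 (g), 8] -/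
theorem noRealZeroEven_fp_11752 :
    ∀ χ : DirichletCharacter ℂ 11752, χ.IsQuadratic → χ.IsPrimitive → χ.Even →
      ∀ σ : ℝ, 0 < σ → σ < 1 → χ.LFunction σ ≠ 0 :=
  good_even_of_eight_blk [13, 113] (by norm_num) (by decide) (by decide) 17 6 88 10 (by decide) (by decide) (by decide)
    (Or.inl (by decide +kernel)) (Or.inr (by decide +kernel))

set_option maxHeartbeats 400000 in
/-- `D = 11897`: the even character `(·/11897)` of conductor `11897` (`11897`: prime) — Fekete–Pólya witness of order `4` along the induced modulus `11897·33 = 392601`, block certificate (digits of `60` bits, splitting depth `10`); est. `5.8` kernel-s. [cite: MontgomeryVaughan2007, §11.2.1 Exercises 7 (g), 8] -/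
theorem noRealZeroEven_fp_11897 :
    ∀ χ : DirichletCharacter ℂ 11897, χ.IsQuadratic → χ.IsPrimitive → χ.Even →
      ∀ σ : ℝ, 0 < σ → σ < 1 → χ.LFunction σ ≠ 0 :=
  good_even_of_odd_blk [11897] (by norm_num) (by decide) (by decide) 33 4 60 10 (by decide) (by decide) (by decide)
    (Or.inr (by decide +kernel))

set_option maxHeartbeats 400000 in
/-- `D = 11965`: the even character `(·/11965)` of conductor `11965` (`11965`: 5 · 2393) — Fekete–Pólya witness of order `7` along the induced modulus `11965·11 = 131615`, block certificate (digits of `99` bits, splitting depth `10`); est. `4.8` kernel-s. [cite: MontgomeryVaughan2007, §11.2.1 Exercises 7 (g), 8] -/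
theorem noRealZeroEven_fp_11965 :
    ∀ χ : DirichletCharacter ℂ 11965, χ.IsQuadratic → χ.IsPrimitive → χ.Even →
      ∀ σ : ℝ, 0 < σ → σ < 1 → χ.LFunction σ ≠ 0 :=
  good_even_of_odd_blk [5, 2393] (by norm_num) (by decide) (by decide) 11 7 99 10 (by decide) (by decide) (by decide)
    (Or.inr (by decide +kernel))

set_option maxHeartbeats 400000 in
/-- `D = 11973`: the even character `(·/11973)` of conductor `11973` (`11973`: 3 · 13 · 307) — Fekete–Pólya witness of order `6` along the induced modulus `11973·10 = 119730`, block certificate (digits of `85` bits, splitting depth `9`); est. `3.5` kernel-s. [cite: MontgomeryVaughan2007, §11.2.1 Exercises 7 (g), 8] -/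
theorem noRealZeroEven_fp_11973 :
    ∀ χ : DirichletCharacter ℂ 11973, χ.IsQuadratic → χ.IsPrimitive → χ.Even →
      ∀ σ : ℝ, 0 < σ → σ < 1 → χ.LFunction σ ≠ 0 :=
  good_even_of_odd_blk [3, 13, 307] (by norm_num) (by decide) (by decide) 10 6 85 9 (by decide) (by decide) (by decide)
    (Or.inr (by decide +kernel))

set_option maxHeartbeats 400000 in
/-- `D = -12056`: the odd character `χ₈·(·/1507)` of conductor `12056` (`1507`: 11 · 137) — Fekete–Pólya witness of order `4` along the induced modulus `12056·13 = 156728`, block certificate (digits of `58` bits, splitting depth `9`); est. `2.1` kernel-s. [cite: MontgomeryVaughan2007, §11.2.1 Exercises 7 (g), 8] -/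
theorem noRealZeroOdd_fp_12056 :
    ∀ χ : DirichletCharacter ℂ 12056, χ.IsQuadratic → χ.IsPrimitive → χ.Odd →
      ∀ σ : ℝ, 0 < σ → σ < 1 → χ.LFunction σ ≠ 0 :=
  good_odd_of_eight_blk [11, 137] (by norm_num) (by decide) (by decide) 13 4 58 9 (by decide) (by decide) (by decide)
    (Or.inl (by decide +kernel)) (Or.inr (by decide +kernel))

set_option maxHeartbeats 400000 in
/-- `D = -12083`: the odd character `(·/12083)` of conductor `12083` (`12083`: 43 · 281) — Fekete–Pólya witness of order `5` along the induced modulus `12083·10 = 120830`, block certificate (digits of `72` bits, splitting depth `9`); est. `2.9` kernel-s. [cite: MontgomeryVaughan2007, §11.2.1 Exercises 7 (g), 8] -/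
theorem noRealZeroOdd_fp_12083 :
    ∀ χ : DirichletCharacter ℂ 12083, χ.IsQuadratic → χ.IsPrimitive → χ.Odd →
      ∀ σ : ℝ, 0 < σ → σ < 1 → χ.LFunction σ ≠ 0 :=
  good_odd_of_odd_blk [43, 281] (by norm_num) (by decide) (by decide) 10 5 72 9 (by decide) (by decide) (by decide)
    (Or.inr (by decide +kernel))

set_option maxHeartbeats 400000 in
/-- `D = 12085`: the even character `(·/12085)` of conductor `12085` (`12085`: 5 · 2417) — Fekete–Pólya witness of order `4` along the induced modulus `12085·22 = 265870`, block certificate (digits of `59` bits, splitting depth `10`); est. `3.6` kernel-s. [cite: MontgomeryVaughan2007, §11.2.1 Exercises 7 (g), 8] -/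
theorem noRealZeroEven_fp_12085 :
    ∀ χ : DirichletCharacter ℂ 12085, χ.IsQuadratic → χ.IsPrimitive → χ.Even →
      ∀ σ : ℝ, 0 < σ → σ < 1 → χ.LFunction σ ≠ 0 :=
  good_even_of_odd_blk [5, 2417] (by norm_num) (by decide) (by decide) 22 4 59 10 (by decide) (by decide) (by decide)
    (Or.inr (by decide +kernel))

set_option maxHeartbeats 400000 in
/-- `D = 12149`: the even character `(·/12149)` of conductor `12149` (`12149`: prime) — Fekete–Pólya witness of order `8` along the induced modulus `12149·13 = 157937`, block certificate (digits of `115` bits, splitting depth `10`); est. `7.5` kernel-s. [cite: MontgomeryVaughan2007, §11.2.1 Exercises 7 (g), 8] -/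
theorem noRealZeroEven_fp_12149 :
    ∀ χ : DirichletCharacter ℂ 12149, χ.IsQuadratic → χ.IsPrimitive → χ.Even →
      ∀ σ : ℝ, 0 < σ → σ < 1 → χ.LFunction σ ≠ 0 :=
  good_even_of_odd_blk [12149] (by norm_num) (by decide) (by decide) 13 8 115 10 (by decide) (by decide) (by decide)
    (Or.inr (by decide +kernel))

set_option maxHeartbeats 400000 in
/-- `D = -12163`: the odd character `(·/12163)` of conductor `12163` (`12163`: prime) — Fekete–Pólya witness of order `7` along the induced modulus `12163·10 = 121630`, block certificate (digits of `100` bits, splitting depth `9`); est. `5.0` kernel-s. [cite: MontgomeryVaughan2007, §11.2.1 Exercises 7 (g), 8] -/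
theorem noRealZeroOdd_fp_12163 :
    ∀ χ : DirichletCharacter ℂ 12163, χ.IsQuadratic → χ.IsPrimitive → χ.Odd →
      ∀ σ : ℝ, 0 < σ → σ < 1 → χ.LFunction σ ≠ 0 :=
  good_odd_of_odd_blk [12163] (by norm_num) (by decide) (by decide) 10 7 100 9 (by decide) (by decide) (by decide)
    (Or.inr (by decide +kernel))

set_option maxHeartbeats 400000 in
/-- `D = 12173`: the even character `(·/12173)` of conductor `12173` (`12173`: 7 · 37 · 47) — Fekete–Pólya witness of order `7` along the induced modulus `12173·10 = 121730`, block certificate (digits of `99` bits, splitting depth `9`); est. `4.3` kernel-s. [cite: MontgomeryVaughan2007, §11.2.1 Exercises 7 (g), 8] -/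
theorem noRealZeroEven_fp_12173 :
    ∀ χ : DirichletCharacter ℂ 12173, χ.IsQuadratic → χ.IsPrimitive → χ.Even →
      ∀ σ : ℝ, 0 < σ → σ < 1 → χ.LFunction σ ≠ 0 :=
  good_even_of_odd_blk [7, 37, 47] (by norm_num) (by decide) (by decide) 10 7 99 9 (by decide) (by decide) (by decide)
    (Or.inr (by decide +kernel))

set_option maxHeartbeats 400000 in
/-- `D = 12188`: the even character `χ₋₄·(·/3047)` of conductor `12188` (`3047`: 11 · 277) — Fekete–Pólya witness of order `3` along the induced modulus `12188·15 = 182820`, block certificate (digits of `40` bits, splitting depth `9`); est. `1.7` kernel-s. [cite: MontgomeryVaughan2007, §11.2.1 Exercises 7 (g), 8] -/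
theorem noRealZeroEven_fp_12188 :
    ∀ χ : DirichletCharacter ℂ 12188, χ.IsQuadratic → χ.IsPrimitive → χ.Even →
      ∀ σ : ℝ, 0 < σ → σ < 1 → χ.LFunction σ ≠ 0 :=
  good_even_of_four_blk [11, 277] (by norm_num) (by decide) (by decide) 15 3 40 9 (by decide) (by decide) (by decide)
    (Or.inr (by decide +kernel))

set_option maxHeartbeats 400000 in
/-- `D = -12235`: the odd character `(·/12235)` of conductor `12235` (`12235`: 5 · 2447) — Fekete–Pólya witness of order `5` along the induced modulus `12235·22 = 269170`, block certificate (digits of `76` bits, splitting depth `11`); est. `6.6` kernel-s. [cite: MontgomeryVaughan2007, §11.2.1 Exercises 7 (g), 8] -/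
theorem noRealZeroOdd_fp_12235 :
    ∀ χ : DirichletCharacter ℂ 12235, χ.IsQuadratic → χ.IsPrimitive → χ.Odd →
      ∀ σ : ℝ, 0 < σ → σ < 1 → χ.LFunction σ ≠ 0 :=
  good_odd_of_odd_blk [5, 2447] (by norm_num) (by decide) (by decide) 22 5 76 11 (by decide) (by decide) (by decide)
    (Or.inr (by decide +kernel))

set_option maxHeartbeats 400000 in
/-- `D = 12248`: the even character `χ₋₈·(·/1531)` of conductor `12248` (`1531`: prime) — Fekete–Pólya witness of order `5` along the induced modulus `12248·15 = 183720`, block certificate (digits of `73` bits, splitting depth `10`); est. `4.5` kernel-s. [cite: MontgomeryVaughan2007, §11.2.1 Exercises 7 (g), 8] -/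
theorem noRealZeroEven_fp_12248 :
    ∀ χ : DirichletCharacter ℂ 12248, χ.IsQuadratic → χ.IsPrimitive → χ.Even →
      ∀ σ : ℝ, 0 < σ → σ < 1 → χ.LFunction σ ≠ 0 :=
  good_even_of_eight_blk [1531] (by norm_num) (by decide) (by decide) 15 5 73 10 (by decide) (by decide) (by decide)
    (Or.inr (by decide +kernel)) (Or.inl (by decide +kernel))

set_option maxHeartbeats 400000 in
/-- `D = -12264`: the odd character `χ₋₈·(·/1533)` of conductor `12264` (`1533`: 3 · 7 · 73) — Fekete–Pólya witness of order `3` along the induced modulus `12264·13 = 159432`, block certificate (digits of `42` bits, splitting depth `9`); est. `1.6` kernel-s. [cite: MontgomeryVaughan2007, §11.2.1 Exercises 7 (g), 8] -/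
theorem noRealZeroOdd_fp_12264 :
    ∀ χ : DirichletCharacter ℂ 12264, χ.IsQuadratic → χ.IsPrimitive → χ.Odd →
      ∀ σ : ℝ, 0 < σ → σ < 1 → χ.LFunction σ ≠ 0 :=
  good_odd_of_eight_blk [3, 7, 73] (by norm_num) (by decide) (by decide) 13 3 42 9 (by decide) (by decide) (by decide)
    (Or.inr (by decide +kernel)) (Or.inl (by decide +kernel))

end Literature.NumberTheory.LFunctions
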